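import Literature.Probability.Percolation.TriAnnulusCircuit
import Literature.Probability.Percolation.TriThetaHalf
import HarnessLib

/-!
# Quasi-multiplicativity and extendability of the one-arm event, uniformly for `p ≥ 1/2` (proofs only)

Topic `Literature/Probability/Percolation`; family `crit-perc`, statement **crit-perc.S16**
(`Literature.Probability.Percolation.triTheta_exponent`, `θ(p) = (p - 1/2)^{5/36 + o(1)}`;
Smirnov–Werner 2001, Thm. 1 (i), via Kesten 1987). A brick of Kesten's near-critical theory in
the form used by P. Nolin, *Near-critical percolation in two dimensions*, Electron. J. Probab. 13
(2008), §6.2, proof of Thm. 27 [arXiv 0711.4948: Thm. 26], Case 1 (`j = 1`), eq. (6.6):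

  `P̃_t(∂S_{2^{k₀}} ↝ ∂S_{2^l}) · P̃_t(∂S_{2^{l+3}} ↝ ∂S_{2^K}) ≤ C₂ P̃_t(∂S_{2^{k₀}} ↝ ∂S_{2^K})`,

with Nolin's footnote: "in the case of one arm, the extendability property, as well as the
quasi-multiplicativity, are direct consequences of RSW and do not require the separation lemmas"
(also §4.5, Props. 16–17 [arXiv 15–16] for `j = 1`; Werner 2009, Lecture 3/5 for `p = 1/2`). We
prove it for the OPEN arm from the origin under `P_t`, UNIFORMLY IN `t ≥ 1/2` and at all scales
(no restriction `N ≤ L(t)` is needed in this direction: open circuits and open crossings are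
increasing events, so their `P_t`-probabilities are at least their `P_{1/2}`-probabilities, which
the Russo–Seymour–Welsh theory at `p = 1/2` bounds below).

## Contents

* `triTBCrossing_subset_triOpenCrossing` — a top–bottom open crossing of the parallelogram
  `R(k, 7k) = [0, k] × [0, 7k]` of `𝕋` crosses the Euclidean annulus `{k + 1 ≤ ‖·‖ ≤ 6k}`
  (bottom sites have norm `≤ k`, top sites have imaginary part `7k · √3/2 > 6k`);
  `exists_pos_le_triOpenCrossing_four` — **RSW lower bound for annulus crossings at `1/2`**:
  `P_{1/2}(C(a, 4a)) ≥ c > 0` for all integers `a ≥ 6` (`tri_rsw_half_holds` at aspect ratio `7`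
  and the symmetry `P(TB(k, 7k)) = P(LR(7k, k))`).
* `triOneArm_quasiMult_euclid` — **the gluing** (Nolin (6.6); LSW 2002, §3, inclusion and
  Harris chain): there is `c > 0` such that for all `t ≥ 1/2`, all integers `a ≥ 1000`, all
  `R ≥ 8a` and `n ≤ R`,
  `c · P_t(C(1, 2a)) · P_t(C(4a, R)) ≤ P_t(0 ↔ ∂Λ_n)`,
  where `C(R₁, R₂) = triOpenCrossing R₁ R₂` is an open path from `‖x‖ < R₁` to `‖y‖ > R₂`
  (`C(1, 2a) = {0 ↔ ‖·‖ > 2a}` is the inner arm, `C(4a, R)` the outer arm). Proof: on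
  `C(1,2a) ∩ [C(a,4a) ∩ A(a,2a)] ∩ [C(2a,8a) ∩ A(2a,4a)] ∩ [C(4a,R) ∩ A(4a,8a)]` the three open
  circuits `A(r, 2r) = triOpenCircuit r (2r)` glue the four open paths into one from `0` to
  `‖·‖ > R ≥ n` (`triOpenCircuit_glue`, `mem_triOneArm_of_pathIn`); Harris's inequality
  (`sitePercolation_real_inter_iInter_ge`, `sitePercolation_harris`), monotonicity in `t`
  (`sitePercolation_real_mono`) and RSW at `1/2` (`BollobasRiordan2006_openCircuit_of_rsw`,
  `exists_pos_le_triOpenCrossing_four`) bound the middle factors below by constants.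
* `triOneArm_quasiMult` — the same with the inner arm `{0 ↔ ∂Λ_m}`, `3a ≤ m`
  (`triOneArm_subset_triOpenCrossing`: `∂Λ_m` lies outside the disc of radius `(√3/2) m > 2a`).
* `triOneArm_extend` — **extendability** (Nolin, Prop. 16 (arXiv 15) for `j = 1`; Werner 2009,
  Lecture 3): `c' · P_t(0 ↔ ∂Λ_m) ≤ P_t(0 ↔ ∂Λ_n)` for `t ≥ 1/2`, `a ≥ 1000`, `3a ≤ m`, `n ≤ 8a`.

## References

* P. Nolin, Near-critical percolation in two dimensions, *Electron. J. Probab.* 13 (2008),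
  §6.2, proof of Thm. 27, Case 1, eq. (6.6) and footnote; §4.5, Props. 16–17
  [arXiv 0711.4948: Thm. 26, Props. 15–16] [Nolin2008].
* G. Lawler, O. Schramm, W. Werner, One-arm exponent for critical 2D percolation, *Electron. J.
  Probab.* 7 (2002), §3 (p. 8: the inclusion and "By the Harris/FKG inequality …")
  [LawlerSchrammWernerEJP2002].
* B. Bollobás, O. Riordan, *Percolation* (2006), Ch. 7, proof of Lemma 4 (RSW circuits)
  [BollobasRiordan2006].
* H. Kesten, Scaling relations for 2D-percolation, *Comm. Math. Phys.* 109 (1987) [KestenScalingCMP1987].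

Mathlib: `Complex.abs_im_le_norm`, `Finset.prod_range_succ`. Tree: `triOpenCrossing`,
`triOpenCircuit`, `triOpenCircuit_glue`, `mem_triOpenCrossing_iff`, `mem_triOpenCrossing_one_iff`,
`mem_triOneArm_of_pathIn`, `triOneArm_subset_triOpenCrossing`, `determinedBy_triOpenCrossing`,
`determinedBy_triOpenCircuit`, `subset_box_of_norm_le`, `sitePercolation_real_inter_iInter_ge`,
`norm_triEmbed_le_triNorm`, `triEmbed_im` (`OneArmLSW.lean`), `BollobasRiordan2006_openCircuit_of_rsw`
(`TriAnnulusCircuit.lean`), `tri_rsw_half_holds` (`TriThetaHalf.lean`),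
`triSitePercolation_real_triTBCrossing`, `triTBCrossing` (`TriHexLemma.lean`),
`sitePercolation_harris`, `sitePercolation_real_mono`, `determinedBy_triOneArm`,
`isUpperSet_triOneArm`.
-/

noncomputable section

open MeasureTheory Set

namespace Literature.Probability.Percolation

open LatticeModels

/-! ### RSW lower bound for annulus crossings at `p = 1/2` -/

/-- A top–bottom open crossing of `R(k, 7k)` (`k ≥ 1`) crosses the annulus between the circles of
radii `k + 1` and `6k` about the origin: bottom sites `(x₀, 0)`, `0 ≤ x₀ ≤ k`, have norm `≤ k`, and
top sites have imaginary part `7k · √3/2 > 6k`. [folklore] -/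
theorem triTBCrossing_subset_triOpenCrossing {k : ℕ} (hk : 1 ≤ k) :
    triTBCrossing k (7 * k) ⊆ triOpenCrossing (k + 1) (6 * k) := by
  intro ω hω
  rw [mem_triTBCrossing_iff] at hω
  obtain ⟨x, hx, y, hy, hconn⟩ := hω
  rw [mem_siteConnIn_iff_pathIn] at hconn
  rw [mem_triOpenCrossing_iff]
  refine ⟨x, y, ?_, ?_, hconn.mono Set.inter_subset_right⟩
  · -- `‖x‖ ≤ |x|_𝕋 = x₀ ≤ k < k + 1`
    have hx' : x ∈ rectangle k (7 * k) ∧ x 1 = 0 := by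
      simpa [bottomSide] using hx
    have hrect := mem_rectangle_iff.1 hx'.1
    have hx1 := hx'.2
    obtain ⟨h0, h0k, -, -⟩ := hrect
    have hnorm : (triNorm x : ℝ) ≤ k := by
      have : triNorm x ≤ k := by
        rw [triNorm_eq_max]; omega
      exact_mod_cast this
    have := norm_triEmbed_le_triNorm x
    linarith
  · -- `‖y‖ ≥ Im y = 7k √3/2 > 6k`
    have hy' : y ∈ rectangle k (7 * k) ∧ y 1 = (7 * k : ℕ) := by
      simpa [topSide] using hy
    have hy1 : (y 1 : ℝ) = 7 * k := by
      have := hy'.2; push_cast at this ⊢; exact_mod_cast this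
    have him : (triEmbed y).im = 7 * k * (Real.sqrt 3 / 2) := by rw [triEmbed_im, hy1]
    have hsqrt : (12 / 7 : ℝ) < Real.sqrt 3 := by
      rw [Real.lt_sqrt (by norm_num)]; norm_num
    have hk1 : (1 : ℝ) ≤ k := by exact_mod_cast hk
    have h1 := Complex.abs_im_le_norm (triEmbed y)
    rw [him] at h1
    have h2 : (6 : ℝ) * k < 7 * k * (Real.sqrt 3 / 2) := by nlinarith
    exact h2.trans_le ((le_abs_self _).trans h1)

/-- **RSW lower bound for annulus crossings at criticality**: there is `c > 0` with
`P_{1/2}(C(a, 4a)) ≥ c` for every integer `a ≥ 6`, `C(R₁, R₂) = triOpenCrossing R₁ R₂` (open path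
from `‖·‖ < R₁` to `‖·‖ > R₂`). From the box-crossing property `tri_rsw_half_holds` at aspect
ratio `7` (Russo 1981; Kesten 1982, §3.4; Werner 2009, Lecture 2) through the top–bottom crossing
of `R(a - 1, 7(a - 1))`. [cite: WernerPCMI2009, Lecture 2 (RSW)] [cite: Nolin2008, §2.3, Thm. 2 (RSW)] -/
theorem exists_pos_le_triOpenCrossing_four :
    ∃ c > (0 : ℝ), ∀ a : ℕ, 6 ≤ a →
      c ≤ (triSitePercolation half).real (triOpenCrossing a (4 * a)) := by
  obtain ⟨c, hc, h⟩ := tri_rsw_half_holds 7 (by norm_num)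
  refine ⟨c, hc, fun a ha => ?_⟩
  set k : ℕ := a - 1 with hk
  have hk1 : 1 ≤ k := by omega
  have hfloor : ⌊(7 : ℝ) * k⌋₊ = 7 * k := by
    rw [show (7 : ℝ) * k = ((7 * k : ℕ) : ℝ) by push_cast; ring, Nat.floor_natCast]
  have h1 : 1 ≤ ⌊(7 : ℝ) * k⌋₊ := by rw [hfloor]; omega
  have hP := (h k h1).1
  rw [hfloor] at hP
  have hsub : triOpenCrossing ((k : ℝ) + 1) (6 * (k : ℝ)) ⊆ triOpenCrossing (a : ℝ) (4 * (a : ℝ)) := by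
    refine triAnnulusCrossing_mono ?_ ?_
    · have : k + 1 = a := by omega
      exact_mod_cast this.le
    · have : 4 * a ≤ 6 * k := by omega
      exact_mod_cast this
  calc c ≤ triLRCrossingProb half (7 * k) k := hP
    _ = (triSitePercolation half).real (triTBCrossing k (7 * k)) :=
        (triSitePercolation_real_triTBCrossing half k (7 * k)).symm
    _ ≤ (triSitePercolation half).real (triOpenCrossing ((k : ℝ) + 1) (6 * (k : ℝ))) :=
        measureReal_mono (triTBCrossing_subset_triOpenCrossing hk1) (measure_ne_top _ _)
    _ ≤ (triSitePercolation half).real (triOpenCrossing (a : ℝ) (4 * (a : ℝ))) :=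
        measureReal_mono hsub (measure_ne_top _ _)

/-! ### The gluing: quasi-multiplicativity of the open arm, uniformly for `t ≥ 1/2` -/

/-- **Deterministic gluing** (LSW 2002, §3, p. 8; Nolin 2008, §6.2, Case 1): on
`C(1, 2a) ∩ [C(a, 4a) ∩ A(a, 2a)] ∩ [C(2a, 8a) ∩ A(2a, 4a)] ∩ [C(4a, R) ∩ A(4a, 8a)]` with
`8a ≤ R`, the origin is joined by an open path to a site of norm `> R`, hence `0 ↔ ∂Λ_n` for
every `n ≤ R`. [cite: LawlerSchrammWernerEJP2002, §3 (p. 8)] -/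
theorem triOneArm_of_glue {a R : ℝ} (ha : 0 < a) (hR : 8 * a ≤ R) {n : ℕ} (hn : (n : ℝ) ≤ R)
    {ω : SiteConfig (Site 2)} (hD : ω ∈ triOpenCrossing 1 (2 * a))
    (h0 : ω ∈ triOpenCrossing a (4 * a) ∩ triOpenCircuit a (2 * a))
    (h1 : ω ∈ triOpenCrossing (2 * a) (8 * a) ∩ triOpenCircuit (2 * a) (4 * a))
    (h2 : ω ∈ triOpenCrossing (4 * a) R ∩ triOpenCircuit (4 * a) (8 * a)) : ω ∈ triOneArm n := by
  obtain ⟨y₀, hy₀, hp₀⟩ := mem_triOpenCrossing_one_iff.1 hD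
  obtain ⟨x₁, y₁, hx₁, hy₁, hp₁⟩ := mem_triOpenCrossing_iff.1 h0.1
  obtain ⟨x₂, y₂, hx₂, hy₂, hp₂⟩ := mem_triOpenCrossing_iff.1 h1.1
  obtain ⟨x₃, y₃, hx₃, hy₃, hp₃⟩ := mem_triOpenCrossing_iff.1 h2.1
  have h00 : ‖triEmbed (0 : Site 2)‖ ≤ a := by simp [ha.le]
  have q₁ : PathIn triGraph ω 0 y₁ :=
    triOpenCircuit_glue h0.2 h00 hy₀.le hp₀ hx₁.le (by linarith) hp₁
  have q₂ : PathIn triGraph ω 0 y₂ :=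
    triOpenCircuit_glue h1.2 (by simp; linarith) (by linarith) q₁ hx₂.le (by linarith) hp₂
  have q₃ : PathIn triGraph ω 0 y₃ :=
    triOpenCircuit_glue h2.2 (by simp; linarith) (by linarith) q₂ hx₃.le (by linarith) hp₃
  exact mem_triOneArm_of_pathIn q₃ (by linarith)

/-- **Quasi-multiplicativity of the one-arm event, uniformly for `p ≥ 1/2`** (Nolin 2008, §6.2,
proof of Thm. 27, Case 1, eq. (6.6): `P̃_t(∂S_{2^{k₀}} ↝ ∂S_{2^l}) P̃_t(∂S_{2^{l+3}} ↝ ∂S_{2^K}) ≤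
C₂ P̃_t(A_{1,σ}(2^{k₀}, 2^K))`, "direct consequences of RSW"; Kesten 1987), Euclidean form: there
is `c > 0` such that for every `t ≥ 1/2`, every integer `a ≥ 1000`, every `R ≥ 8a` and `n ≤ R`,
`c · P_t(C(1, 2a)) · P_t(C(4a, R)) ≤ P_t(0 ↔ ∂Λ_n)` — the inner arm `C(1, 2a) = {0 ↔ ‖·‖ > 2a}`
and the outer arm `C(4a, R)` (open path from `‖·‖ < 4a` to `‖·‖ > R`) glue, through three RSW
circuits and two RSW crossings whose `P_t`-probabilities are at least their `P_{1/2}`-probabilities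
(increasing events), to an arm `0 ↔ ∂Λ_n` (Harris–FKG). [cite: Nolin2008, §6.2, proof of Thm. 27, Case 1, eq. (6.6) (arXiv 0711.4948: Thm. 26)] [cite: LawlerSchrammWernerEJP2002, §3 (p. 8)] -/
theorem triOneArm_quasiMult_euclid :
    ∃ c > (0 : ℝ), ∀ t : unitInterval, 1 / 2 ≤ (t : ℝ) → ∀ a : ℕ, 1000 ≤ a →
      ∀ R : ℝ, 8 * (a : ℝ) ≤ R → ∀ n : ℕ, (n : ℝ) ≤ R →
        c * ((triSitePercolation t).real (triOpenCrossing 1 (2 * a)) *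
            (triSitePercolation t).real (triOpenCrossing (4 * a) R)) ≤
          (triSitePercolation t).real (triOneArm n) := by
  obtain ⟨cA, hcA, hA⟩ := BollobasRiordan2006_openCircuit_of_rsw tri_rsw_half_holds
  obtain ⟨cX, hcX, hX⟩ := exists_pos_le_triOpenCrossing_four
  refine ⟨(cX * cA) * (cX * cA) * cA, by positivity, fun t ht a ha R hR n hn => ?_⟩
  have ha0 : (0 : ℝ) < a := by exact_mod_cast (show 0 < a by omega)
  have ha' : (1000 : ℝ) ≤ a := by exact_mod_cast ha
  have hht : half ≤ t := Subtype.coe_le_coe.1 (by rw [coe_half]; exact ht)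
  -- the events
  set D : Set (SiteConfig (Site 2)) := triOpenCrossing 1 (2 * a) with hDdef
  set Y : ℕ → Set (SiteConfig (Site 2)) := fun j =>
    if j = 0 then triOpenCrossing (a : ℝ) (4 * a) ∩ triOpenCircuit (a : ℝ) (2 * a)
    else if j = 1 then triOpenCrossing (2 * (a : ℝ)) (8 * a) ∩ triOpenCircuit (2 * (a : ℝ)) (4 * a)
    else triOpenCrossing (4 * (a : ℝ)) R ∩ triOpenCircuit (4 * (a : ℝ)) (8 * a) with hYdef
  have hY0 : Y 0 = (triOpenCrossing (a : ℝ) (4 * a) ∩ triOpenCircuit (a : ℝ) (2 * a)) := by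
    simp [hYdef]
  have hY1 : Y 1 = (triOpenCrossing (2 * (a : ℝ)) (8 * a) ∩ triOpenCircuit (2 * (a : ℝ)) (4 * a)) := by
    simp [hYdef]
  have hY2 : Y 2 = (triOpenCrossing (4 * (a : ℝ)) R ∩ triOpenCircuit (4 * (a : ℝ)) (8 * a)) := by
    simp [hYdef]
  -- one finite set of sites determining everything
  set F : Finset (Site 2) := box 2 ⌈2 * (R + 1)⌉₊ with hF
  have hdetC : ∀ {R₁ R₂ : ℝ}, R₁ ≤ R₂ → R₂ ≤ R → DeterminedBy (triOpenCrossing R₁ R₂) ↑F :=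
    fun hle hR₂ => (determinedBy_triOpenCrossing hle).mono
      (subset_box_of_norm_le fun v hv => hv.2.trans (by linarith))
  have hdetA : ∀ {R₁ R₂ : ℝ}, R₂ ≤ R → DeterminedBy (triOpenCircuit R₁ R₂) ↑F :=
    fun hR₂ => (determinedBy_triOpenCircuit _ _).mono
      (subset_box_of_norm_le fun v hv => hv.2.le.trans (by linarith))
  have hdetD : DeterminedBy D ↑F := hdetC (by linarith) (by linarith)
  have hdetY : ∀ j < 3, DeterminedBy (Y j) ↑F := by
    intro j hj
    interval_cases j
    · rw [hY0]; exact (hdetC (by linarith) (by linarith)).inter (hdetA (by linarith))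
    · rw [hY1]; exact (hdetC (by linarith) (by linarith)).inter (hdetA (by linarith))
    · rw [hY2]; exact (hdetC (by linarith) le_rfl).inter (hdetA (by linarith))
  have hupY : ∀ j < 3, IsUpperSet (Y j) := by
    intro j hj
    interval_cases j
    · rw [hY0]; exact (isUpperSet_triOpenCrossing _ _).inter (isUpperSet_triOpenCircuit _ _)
    · rw [hY1]; exact (isUpperSet_triOpenCrossing _ _).inter (isUpperSet_triOpenCircuit _ _)
    · rw [hY2]; exact (isUpperSet_triOpenCrossing _ _).inter (isUpperSet_triOpenCircuit _ _)
  -- the inclusion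
  have hincl : D ∩ ⋂ j < 3, Y j ⊆ triOneArm n := by
    rintro ω ⟨hωD, hωY⟩
    simp only [Set.mem_iInter] at hωY
    have h0 := hωY 0 (by norm_num); rw [hY0] at h0
    have h1 := hωY 1 (by norm_num); rw [hY1] at h1
    have h2 := hωY 2 (by norm_num); rw [hY2] at h2
    exact triOneArm_of_glue ha0 hR hn hωD h0 h1 h2
  -- Harris chain under `P_t`
  have hchain := sitePercolation_real_inter_iInter_ge t (F := F) (D := D) (Y := Y) hdetD
    (isUpperSet_triOpenCrossing _ _) (N := 3) hdetY hupY
  -- lower bounds for the three middle factors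
  have hPA : ∀ {r : ℝ}, 1000 ≤ r → 2 * r ≤ R →
      cA ≤ (sitePercolation (Site 2) t).real (triOpenCircuit r (2 * r)) := by
    intro r hr hrR
    calc cA ≤ (triSitePercolation half).real (triOpenCircuit r (2 * r)) := hA r hr
      _ ≤ (sitePercolation (Site 2) t).real (triOpenCircuit r (2 * r)) :=
          sitePercolation_real_mono (hdetA hrR) (isUpperSet_triOpenCircuit _ _) hht
  have hPX : ∀ {b : ℕ}, 6 ≤ b → 4 * (b : ℝ) ≤ R →
      cX ≤ (sitePercolation (Site 2) t).real (triOpenCrossing b (4 * b)) := by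
    intro b hb hbR
    calc cX ≤ (triSitePercolation half).real (triOpenCrossing b (4 * b)) := hX b hb
      _ ≤ (sitePercolation (Site 2) t).real (triOpenCrossing b (4 * b)) :=
          sitePercolation_real_mono (hdetC (by have : (0:ℝ) ≤ b := Nat.cast_nonneg b; linarith) hbR)
            (isUpperSet_triOpenCrossing _ _) hht
  have hb0 : cX * cA ≤ (sitePercolation (Site 2) t).real (Y 0) := by
    rw [hY0]
    calc cX * cA ≤ (sitePercolation (Site 2) t).real (triOpenCrossing (a : ℝ) (4 * a)) *
          (sitePercolation (Site 2) t).real (triOpenCircuit (a : ℝ) (2 * a)) :=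
          mul_le_mul (hPX (by omega) (by linarith)) (hPA (by exact_mod_cast ha) (by linarith))
            hcA.le measureReal_nonneg
      _ ≤ _ := sitePercolation_harris t (hdetC (by linarith) (by linarith)) (hdetA (by linarith))
          (isUpperSet_triOpenCrossing _ _) (isUpperSet_triOpenCircuit _ _)
  have hb1 : cX * cA ≤ (sitePercolation (Site 2) t).real (Y 1) := by
    rw [hY1]
    have h2a : ((2 * a : ℕ) : ℝ) = 2 * (a : ℝ) := by push_cast; ring
    have hx := hPX (b := 2 * a) (by omega) (by rw [h2a]; linarith)
    rw [h2a, show (4 : ℝ) * (2 * (a : ℝ)) = 8 * a by ring] at hx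
    calc cX * cA ≤ (sitePercolation (Site 2) t).real (triOpenCrossing (2 * (a : ℝ)) (8 * a)) *
          (sitePercolation (Site 2) t).real (triOpenCircuit (2 * (a : ℝ)) (4 * a)) :=
          mul_le_mul hx (by
            have := hPA (r := 2 * (a : ℝ)) (by linarith) (by linarith)
            rwa [show (2 : ℝ) * (2 * (a : ℝ)) = 4 * a by ring] at this) hcA.le measureReal_nonneg
      _ ≤ _ := sitePercolation_harris t (hdetC (by linarith) (by linarith)) (hdetA (by linarith))
          (isUpperSet_triOpenCrossing _ _) (isUpperSet_triOpenCircuit _ _)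
  have hb2 : (sitePercolation (Site 2) t).real (triOpenCrossing (4 * (a : ℝ)) R) * cA ≤
      (sitePercolation (Site 2) t).real (Y 2) := by
    rw [hY2]
    calc (sitePercolation (Site 2) t).real (triOpenCrossing (4 * (a : ℝ)) R) * cA
        ≤ (sitePercolation (Site 2) t).real (triOpenCrossing (4 * (a : ℝ)) R) *
          (sitePercolation (Site 2) t).real (triOpenCircuit (4 * (a : ℝ)) (8 * a)) :=
          mul_le_mul_of_nonneg_left (by
            have := hPA (r := 4 * (a : ℝ)) (by linarith) (by linarith)
            rwa [show (2 : ℝ) * (4 * (a : ℝ)) = 8 * a by ring] at this) measureReal_nonneg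
      _ ≤ _ := sitePercolation_harris t (hdetC (by linarith) le_rfl) (hdetA (by linarith))
          (isUpperSet_triOpenCrossing _ _) (isUpperSet_triOpenCircuit _ _)
  -- assemble
  have hprod : ∏ j ∈ Finset.range 3, (sitePercolation (Site 2) t).real (Y j) =
      (sitePercolation (Site 2) t).real (Y 0) * (sitePercolation (Site 2) t).real (Y 1) *
        (sitePercolation (Site 2) t).real (Y 2) := by
    simp [Finset.prod_range_succ]
  have hDn : 0 ≤ (sitePercolation (Site 2) t).real D := measureReal_nonneg
  have hX2n : 0 ≤ (sitePercolation (Site 2) t).real (triOpenCrossing (4 * (a : ℝ)) R) :=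
    measureReal_nonneg
  calc cX * cA * (cX * cA) * cA * ((triSitePercolation t).real D *
        (triSitePercolation t).real (triOpenCrossing (4 * (a : ℝ)) R))
      = (sitePercolation (Site 2) t).real D * ((cX * cA) * (cX * cA) *
          ((sitePercolation (Site 2) t).real (triOpenCrossing (4 * (a : ℝ)) R) * cA)) := by
        show cX * cA * (cX * cA) * cA * ((sitePercolation (Site 2) t).real D *
          (sitePercolation (Site 2) t).real (triOpenCrossing (4 * (a : ℝ)) R)) = _
        ring
    _ ≤ (sitePercolation (Site 2) t).real D * ((sitePercolation (Site 2) t).real (Y 0) *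
          (sitePercolation (Site 2) t).real (Y 1) * (sitePercolation (Site 2) t).real (Y 2)) := by
        refine mul_le_mul_of_nonneg_left ?_ hDn
        have h01 : (cX * cA) * (cX * cA) ≤ (sitePercolation (Site 2) t).real (Y 0) *
            (sitePercolation (Site 2) t).real (Y 1) :=
          mul_le_mul hb0 hb1 (by positivity) measureReal_nonneg
        exact mul_le_mul h01 hb2 (by positivity) (by positivity)
    _ = (sitePercolation (Site 2) t).real D *
          ∏ j ∈ Finset.range 3, (sitePercolation (Site 2) t).real (Y j) := by rw [hprod]
    _ ≤ (sitePercolation (Site 2) t).real (D ∩ ⋂ j < 3, Y j) := hchain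
    _ ≤ (triSitePercolation t).real (triOneArm n) :=
        measureReal_mono hincl (measure_ne_top _ _)

/-- **Quasi-multiplicativity of the one-arm event with the hexagonal inner arm** (Nolin 2008,
§6.2, eq. (6.6), `j = 1`; Kesten 1987): there is `c > 0` such that for all `t ≥ 1/2`, all integers
`a ≥ 1000`, `m ≥ 3a`, all `R ≥ 8a` and `n ≤ R`,
`c · P_t(0 ↔ ∂Λ_m) · P_t(C(4a, R)) ≤ P_t(0 ↔ ∂Λ_n)` (`∂Λ_m` lies outside the disc of radius
`(√3/2) m > 2a`, so `{0 ↔ ∂Λ_m} ⊆ C(1, 2a)`). [cite: Nolin2008, §6.2, proof of Thm. 27, Case 1, eq. (6.6) (arXiv 0711.4948: Thm. 26)] -/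
theorem triOneArm_quasiMult :
    ∃ c > (0 : ℝ), ∀ t : unitInterval, 1 / 2 ≤ (t : ℝ) → ∀ a : ℕ, 1000 ≤ a → ∀ m : ℕ, 3 * a ≤ m →
      ∀ R : ℝ, 8 * (a : ℝ) ≤ R → ∀ n : ℕ, (n : ℝ) ≤ R →
        c * ((triSitePercolation t).real (triOneArm m) *
            (triSitePercolation t).real (triOpenCrossing (4 * a) R)) ≤
          (triSitePercolation t).real (triOneArm n) := by
  obtain ⟨c, hc, h⟩ := triOneArm_quasiMult_euclid
  refine ⟨c, hc, fun t ht a ha m hm R hR n hn => le_trans ?_ (h t ht a ha R hR n hn)⟩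
  have hsqrt : (17 / 10 : ℝ) < Real.sqrt 3 := by
    rw [Real.lt_sqrt (by norm_num)]; norm_num
  have hm' : (3 : ℝ) * a ≤ m := by exact_mod_cast hm
  have ha0 : (0 : ℝ) < a := by exact_mod_cast (show 0 < a by omega)
  have h1 : Real.sqrt 3 / 2 * (3 * (a : ℝ)) ≤ Real.sqrt 3 / 2 * m :=
    mul_le_mul_of_nonneg_left hm' (by positivity)
  have h2 : (2 : ℝ) * a < Real.sqrt 3 / 2 * (3 * (a : ℝ)) := by
    nlinarith [mul_pos (sub_pos.2 hsqrt) ha0]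
  have hsub : triOneArm m ⊆ triOpenCrossing 1 (2 * (a : ℝ)) :=
    triOneArm_subset_triOpenCrossing one_pos (h2.trans_le h1)
  have hmono : (triSitePercolation t).real (triOneArm m) ≤
      (triSitePercolation t).real (triOpenCrossing 1 (2 * (a : ℝ))) :=
    measureReal_mono hsub (measure_ne_top _ _)
  have h0 : 0 ≤ (triSitePercolation t).real (triOpenCrossing (4 * (a : ℝ)) R) := measureReal_nonneg
  exact mul_le_mul_of_nonneg_left (mul_le_mul_of_nonneg_right hmono h0) hc.le

/-- **Extendability of the one-arm event, uniformly for `p ≥ 1/2`** (Nolin 2008, §4.5, Prop. 16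
[arXiv Prop. 15] for `j = 1`, "a direct consequence of RSW" (footnote in §6.2); Werner 2009,
Lecture 3): there is `c > 0` such that `c · P_t(0 ↔ ∂Λ_m) ≤ P_t(0 ↔ ∂Λ_n)` for all `t ≥ 1/2`, all
integers `a ≥ 1000`, `m ≥ 3a` and `n ≤ 8a` — the outer arm `C(4a, 8a) ⊇ C(4a, 16a)` of
`triOneArm_quasiMult` has `P_t`-probability at least the RSW constant. [cite: Nolin2008, §4.5, Prop. 16 (arXiv 0711.4948: Prop. 15), j = 1] -/
theorem triOneArm_extend :
    ∃ c > (0 : ℝ), ∀ t : unitInterval, 1 / 2 ≤ (t : ℝ) → ∀ a : ℕ, 1000 ≤ a → ∀ m n : ℕ,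
      3 * a ≤ m → n ≤ 8 * a →
        c * (triSitePercolation t).real (triOneArm m) ≤ (triSitePercolation t).real (triOneArm n) := by
  obtain ⟨c, hc, h⟩ := triOneArm_quasiMult
  obtain ⟨cX, hcX, hX⟩ := exists_pos_le_triOpenCrossing_four
  refine ⟨c * cX, mul_pos hc hcX, fun t ht a ha m n hm hn => ?_⟩
  have hht : half ≤ t := Subtype.coe_le_coe.1 (by rw [coe_half]; exact ht)
  have hn' : (n : ℝ) ≤ 8 * (a : ℝ) := by exact_mod_cast hn
  have hmain := h t ht a ha m hm (8 * a) le_rfl n hn'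
  -- `P_t(C(4a, 8a)) ≥ P_{1/2}(C(4a, 16a)) ≥ cX`
  have h4a : ((4 * a : ℕ) : ℝ) = 4 * (a : ℝ) := by push_cast; ring
  have hsub : triOpenCrossing ((4 * a : ℕ) : ℝ) (4 * ((4 * a : ℕ) : ℝ)) ⊆
      triOpenCrossing (4 * (a : ℝ)) (8 * (a : ℝ)) := by
    rw [h4a]
    exact triAnnulusCrossing_mono le_rfl (by have : (0 : ℝ) ≤ a := Nat.cast_nonneg a; linarith)
  have hdet : DeterminedBy (triOpenCrossing (4 * (a : ℝ)) (8 * (a : ℝ)))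
      ↑(box 2 ⌈2 * (8 * (a : ℝ) + 1)⌉₊) :=
    (determinedBy_triOpenCrossing (by have : (0 : ℝ) ≤ a := Nat.cast_nonneg a; linarith)).mono
      (subset_box_of_norm_le fun v hv => hv.2)
  have hXt : cX ≤ (triSitePercolation t).real (triOpenCrossing (4 * (a : ℝ)) (8 * (a : ℝ))) :=
    calc cX ≤ (triSitePercolation half).real (triOpenCrossing ((4 * a : ℕ) : ℝ) (4 * ((4 * a : ℕ) : ℝ))) :=
          hX (4 * a) (by omega)
      _ ≤ (triSitePercolation half).real (triOpenCrossing (4 * (a : ℝ)) (8 * (a : ℝ))) :=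
          measureReal_mono hsub (measure_ne_top _ _)
      _ ≤ (triSitePercolation t).real (triOpenCrossing (4 * (a : ℝ)) (8 * (a : ℝ))) :=
          sitePercolation_real_mono hdet (isUpperSet_triOpenCrossing _ _) hht
  have h1 : 0 ≤ (triSitePercolation t).real (triOneArm m) := measureReal_nonneg
  calc c * cX * (triSitePercolation t).real (triOneArm m)
      = c * ((triSitePercolation t).real (triOneArm m) * cX) := by ring
    _ ≤ c * ((triSitePercolation t).real (triOneArm m) *
          (triSitePercolation t).real (triOpenCrossing (4 * (a : ℝ)) (8 * (a : ℝ)))) :=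
        mul_le_mul_of_nonneg_left (mul_le_mul_of_nonneg_left hXt h1) hc.le
    _ ≤ (triSitePercolation t).real (triOneArm n) := hmain

end Literature.Probability.Percolation
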